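import Summits.CriticalPhenomena.PercolationContinuityZ3.Theorems.SahiAECornerEnvelopeLocal

/-!
# The lower-corner essential envelope as an explicit operator

Support file of the Sahi cell (`prim-sahi`, typer seat, generation 23; `--supports stmt-CriticalPhenomena-4575`).
Three small definitions (`cornerRadius`, `cornerEssSup`, `cornerEnvelope`) and their API; no named facts, no sorries.

`SahiAECornerEnvelope(Local,Pos).lean` (typer g20–g22) prove the EXISTENCE of a Borel everywhere-MTP₂ (and monotone)
version of an a.e.-MTP₂, a.e.-monotone density `g : ℝ^ι → [0,∞]`, namely the lower-corner essential envelope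
`F(p) = inf_n ess sup_{∏ᵢ (pᵢ − 1/(n+1), pᵢ]} g`; the envelope itself stays hidden behind the existential.  The
structure theorem in every dimension (`SahiAEOrthant*.lean`, this generation) compares the envelopes of TWO densities
that differ by a separable factor, which needs the operator and not only its existence.  This file therefore names it,

* `cornerEssSup g n p = ess sup_{∏ᵢ (pᵢ − rₙ, pᵢ]} g`, `rₙ = 1/(n+1)` (`cornerRadius`), `cornerEnvelope g p = ⨅ₙ …`,

and re-proves the properties for the named operator: antitone in `n` with limit the envelope, Borel in `p`
(`measurable_cornerEnvelope`), comparison lemmas (`cornerEssSup_le_of_ae_le`, `cornerEssSup_le_mul`,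
`mul_cornerEssSup_le`), monotone in `p` for an a.e.-monotone density (`cornerEssSup_mono`, from
`essSup_lowerCorner_mono`), MTP₂ at every pair (`cornerEssSup_mul_le`, `cornerEnvelope_mul_le`), and `= g` almost
everywhere for an a.e.-monotone density (`cornerEnvelope_ae_eq`: Lebesgue density points, a corner box being a
`2^{-|ι|}`-th of the sup-norm ball).  The proofs are those of `exists_measurable_monotone_mtp2_version_of_ae_local`,
reorganised as an API.  No sorries, no new axioms.
-/

noncomputable section

namespace Summit.CriticalPhenomena.PercolationContinuityZ3.Theorems.SahiAEFourFunctions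

open MeasureTheory Set Filter Topology Metric
open scoped ENNReal NNReal

variable {ι : Type*} [Fintype ι]

/-! ### Radii -/

/-- The radii `rₙ = 1/(n+1)` of the corner boxes. [this work] -/
def cornerRadius (n : ℕ) : ℝ := ((n : ℝ) + 1)⁻¹

/-- `rₙ > 0`. [folklore] -/
theorem cornerRadius_pos (n : ℕ) : 0 < cornerRadius n := by
  unfold cornerRadius; positivity

/-- `rₙ ≤ 1`. [folklore] -/
theorem cornerRadius_le_one (n : ℕ) : cornerRadius n ≤ 1 := by
  unfold cornerRadius
  have : (1 : ℝ) ≤ (n : ℝ) + 1 := by have := Nat.cast_nonneg (α := ℝ) n; linarith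
  exact inv_le_one_of_one_le₀ this

/-- The radii decrease. [folklore] -/
theorem cornerRadius_antitone : Antitone cornerRadius := fun m n hmn => by
  unfold cornerRadius
  have hmn' : (m : ℝ) ≤ n := by exact_mod_cast hmn
  exact inv_anti₀ (by positivity) (by linarith)

/-- The radii tend to `0`. [folklore] -/
theorem tendsto_cornerRadius_zero : Tendsto cornerRadius atTop (𝓝 0) := by
  have h := tendsto_one_div_add_atTop_nhds_zero_nat (𝕜 := ℝ)
  refine h.congr fun n => ?_
  simp only [cornerRadius, one_div]

/-- The radii tend to `0` from the right. [folklore] -/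
theorem tendsto_cornerRadius : Tendsto cornerRadius atTop (𝓝[>] 0) :=
  tendsto_nhdsWithin_iff.2 ⟨tendsto_cornerRadius_zero, Eventually.of_forall fun n => cornerRadius_pos n⟩

/-- Every positive number eventually dominates the radii. [folklore] -/
theorem eventually_cornerRadius_lt {ε : ℝ} (hε : 0 < ε) : ∀ᶠ n in atTop, cornerRadius n < ε :=
  (tendsto_order.1 tendsto_cornerRadius_zero).2 _ hε

/-! ### The corner essential supremum and the envelope -/

/-- `cornerEssSup g n p = ess sup_{∏ᵢ (pᵢ − rₙ, pᵢ]} g`, the essential supremum of `g` over the lower corner box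
of radius `rₙ = 1/(n+1)` at `p` (Lebesgue measure). [this work] -/
def cornerEssSup (g : (ι → ℝ) → ℝ≥0∞) (n : ℕ) (p : ι → ℝ) : ℝ≥0∞ :=
  essSup g ((volume : Measure (ι → ℝ)).restrict (Set.pi univ fun i => Ioc (p i - cornerRadius n) (p i)))

/-- **The lower-corner essential envelope** `cornerEnvelope g p = infₙ ess sup_{∏ᵢ (pᵢ − rₙ, pᵢ]} g`. [this work] -/
def cornerEnvelope (g : (ι → ℝ) → ℝ≥0∞) (p : ι → ℝ) : ℝ≥0∞ := ⨅ n, cornerEssSup g n p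

/-- Unfolding lemma. [folklore] -/
theorem cornerEssSup_def (g : (ι → ℝ) → ℝ≥0∞) (n : ℕ) (p : ι → ℝ) :
    cornerEssSup g n p =
      essSup g ((volume : Measure (ι → ℝ)).restrict (Set.pi univ fun i => Ioc (p i - cornerRadius n) (p i))) := rfl

/-- Unfolding lemma. [folklore] -/
theorem cornerEnvelope_def (g : (ι → ℝ) → ℝ≥0∞) (p : ι → ℝ) : cornerEnvelope g p = ⨅ n, cornerEssSup g n p := rfl

/-- The corner boxes have positive volume. [folklore] -/
theorem volume_lowerCorner_ne_zero (p : ι → ℝ) (n : ℕ) :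
    volume (Set.pi univ fun i => Ioc (p i - cornerRadius n) (p i)) ≠ 0 := by
  rw [volume_lowerCorner]
  exact pow_ne_zero _ (ENNReal.ofReal_pos.2 (cornerRadius_pos n)).ne'

/-- The restricted measure of a corner box is not the zero measure. [folklore] -/
theorem volume_restrict_lowerCorner_ne_zero (p : ι → ℝ) (n : ℕ) :
    (volume : Measure (ι → ℝ)).restrict (Set.pi univ fun i => Ioc (p i - cornerRadius n) (p i)) ≠ 0 := by
  intro h0
  have h1 : volume (Set.pi univ fun i => Ioc (p i - cornerRadius n) (p i)) = 0 := by
    rw [← Measure.restrict_apply_self, h0]; rfl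
  exact volume_lowerCorner_ne_zero p n h1

/-- The corner essential suprema decrease with `n` (the boxes shrink). [this work] -/
theorem cornerEssSup_antitone (g : (ι → ℝ) → ℝ≥0∞) (p : ι → ℝ) : Antitone fun n => cornerEssSup g n p := by
  intro m n hmn
  simp only [cornerEssSup]
  refine essSup_mono_measure' (Measure.restrict_mono (fun x hx => ?_) le_rfl)
  rw [Set.mem_univ_pi] at hx ⊢
  intro i
  exact ⟨lt_of_le_of_lt (sub_le_sub_left (cornerRadius_antitone hmn) _) (hx i).1, (hx i).2⟩

/-- The envelope is below every corner essential supremum. [folklore] -/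
theorem cornerEnvelope_le_cornerEssSup (g : (ι → ℝ) → ℝ≥0∞) (n : ℕ) (p : ι → ℝ) :
    cornerEnvelope g p ≤ cornerEssSup g n p := iInf_le _ n

/-- The corner essential suprema tend to the envelope. [folklore] -/
theorem tendsto_cornerEssSup (g : (ι → ℝ) → ℝ≥0∞) (p : ι → ℝ) :
    Tendsto (fun n => cornerEssSup g n p) atTop (𝓝 (cornerEnvelope g p)) :=
  tendsto_atTop_iInf (cornerEssSup_antitone g p)

/-- The envelope only depends on the tail of the sequence of corner essential suprema. [folklore] -/
theorem cornerEnvelope_eq_iInf_ge (g : (ι → ℝ) → ℝ≥0∞) (p : ι → ℝ) (n₀ : ℕ) :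
    cornerEnvelope g p = ⨅ n, cornerEssSup g (n + n₀) p := by
  apply le_antisymm
  · exact le_iInf fun n => iInf_le _ _
  · refine le_iInf fun n => (iInf_le _ n).trans ?_
    exact cornerEssSup_antitone g p (Nat.le_add_right n n₀)

/-- Borel measurability of `p ↦ cornerEssSup g n p`. [this work] -/
theorem measurable_cornerEssSup {g : (ι → ℝ) → ℝ≥0∞} (hg : Measurable g) (n : ℕ) :
    Measurable (cornerEssSup g n) :=
  measurable_essSup_lowerCorner hg (cornerRadius n)

/-- Borel measurability of the envelope. [this work] -/
theorem measurable_cornerEnvelope {g : (ι → ℝ) → ℝ≥0∞} (hg : Measurable g) : Measurable (cornerEnvelope g) :=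
  Measurable.iInf fun n => measurable_cornerEssSup hg n

/-! ### Comparison lemmas -/

/-- A pointwise lower bound of the density bounds the corner essential suprema from below. [folklore] -/
theorem le_cornerEssSup_of_forall_le {g : (ι → ℝ) → ℝ≥0∞} {c₀ : ℝ≥0∞} (hcg : ∀ x, c₀ ≤ g x) (n : ℕ)
    (p : ι → ℝ) : c₀ ≤ cornerEssSup g n p := by
  calc c₀ = essSup (fun _ : ι → ℝ => c₀)
        ((volume : Measure (ι → ℝ)).restrict (Set.pi univ fun i => Ioc (p i - cornerRadius n) (p i))) :=
        (essSup_const _ (volume_restrict_lowerCorner_ne_zero p n)).symm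
    _ ≤ cornerEssSup g n p := essSup_mono_ae (Eventually.of_forall fun x => hcg x)

/-- A pointwise lower bound of the density bounds the envelope from below. [folklore] -/
theorem le_cornerEnvelope_of_forall_le {g : (ι → ℝ) → ℝ≥0∞} {c₀ : ℝ≥0∞} (hcg : ∀ x, c₀ ≤ g x) (p : ι → ℝ) :
    c₀ ≤ cornerEnvelope g p := le_iInf fun n => le_cornerEssSup_of_forall_le hcg n p

/-- An almost-everywhere bound on the corner box bounds the corner essential supremum. [folklore] -/
theorem cornerEssSup_le_of_ae_restrict_le {g : (ι → ℝ) → ℝ≥0∞} {M : ℝ≥0∞} {n : ℕ} {p : ι → ℝ}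
    (h : ∀ᵐ z ∂(volume : Measure (ι → ℝ)).restrict (Set.pi univ fun i => Ioc (p i - cornerRadius n) (p i)),
      g z ≤ M) : cornerEssSup g n p ≤ M := essSup_le_of_ae_le M h

/-- An almost-everywhere bound below the corner bounds the corner essential supremum. [folklore] -/
theorem cornerEssSup_le_of_ae_le {g : (ι → ℝ) → ℝ≥0∞} {M : ℝ≥0∞} {p : ι → ℝ}
    (h : ∀ᵐ z ∂(volume : Measure (ι → ℝ)), z ≤ p → g z ≤ M) (n : ℕ) : cornerEssSup g n p ≤ M := by
  refine cornerEssSup_le_of_ae_restrict_le ?_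
  rw [ae_restrict_iff' (measurableSet_lowerCorner p _)]
  filter_upwards [h] with z hz hzC
  exact hz (le_of_mem_lowerCorner hzC)

/-- The envelope is bounded by an almost-everywhere bound below the corner. [folklore] -/
theorem cornerEnvelope_le_of_ae_le {g : (ι → ℝ) → ℝ≥0∞} {M : ℝ≥0∞} {p : ι → ℝ}
    (h : ∀ᵐ z ∂(volume : Measure (ι → ℝ)), z ≤ p → g z ≤ M) : cornerEnvelope g p ≤ M :=
  (cornerEnvelope_le_cornerEssSup g 0 p).trans (cornerEssSup_le_of_ae_le h 0)

/-- **Comparison with a multiple**: if `g' ≤ K g` almost everywhere on the corner box then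
`cornerEssSup g' n p ≤ K · cornerEssSup g n p`. [folklore] -/
theorem cornerEssSup_le_mul {g g' : (ι → ℝ) → ℝ≥0∞} {K : ℝ≥0∞} {n : ℕ} {p : ι → ℝ}
    (h : ∀ᵐ z ∂(volume : Measure (ι → ℝ)).restrict (Set.pi univ fun i => Ioc (p i - cornerRadius n) (p i)),
      g' z ≤ K * g z) : cornerEssSup g' n p ≤ K * cornerEssSup g n p := by
  rw [cornerEssSup, cornerEssSup, ← ENNReal.essSup_const_mul]
  exact essSup_mono_ae h

/-- **Comparison with a multiple**, the other direction: if `K g ≤ g'` almost everywhere on the corner box then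
`K · cornerEssSup g n p ≤ cornerEssSup g' n p`. [folklore] -/
theorem mul_cornerEssSup_le {g g' : (ι → ℝ) → ℝ≥0∞} {K : ℝ≥0∞} {n : ℕ} {p : ι → ℝ}
    (h : ∀ᵐ z ∂(volume : Measure (ι → ℝ)).restrict (Set.pi univ fun i => Ioc (p i - cornerRadius n) (p i)),
      K * g z ≤ g' z) : K * cornerEssSup g n p ≤ cornerEssSup g' n p := by
  rw [cornerEssSup, cornerEssSup, ← ENNReal.essSup_const_mul]
  exact essSup_mono_ae h

/-- Two densities that agree almost everywhere on the corner box have the same corner essential supremum.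
[folklore] -/
theorem cornerEssSup_congr_ae {g g' : (ι → ℝ) → ℝ≥0∞} {n : ℕ} {p : ι → ℝ}
    (h : ∀ᵐ z ∂(volume : Measure (ι → ℝ)).restrict (Set.pi univ fun i => Ioc (p i - cornerRadius n) (p i)),
      g' z = g z) : cornerEssSup g' n p = cornerEssSup g n p :=
  essSup_congr_ae h

/-! ### Local finiteness -/

/-- Under a local bound below every point the corner essential suprema are finite. [this work] -/
theorem cornerEssSup_ne_top_of_local {g : (ι → ℝ) → ℝ≥0∞}
    (hloc : ∀ q : ι → ℝ, ∃ M : ℝ≥0∞, M ≠ ∞ ∧ ∀ᵐ z ∂(volume : Measure (ι → ℝ)), z ≤ q → g z ≤ M)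
    (n : ℕ) (p : ι → ℝ) : cornerEssSup g n p ≠ ∞ := by
  obtain ⟨M, hM, hle⟩ := hloc p
  exact ne_top_of_le_ne_top hM (cornerEssSup_le_of_ae_le hle n)

/-- If the largest corner essential supremum is finite then so is the envelope. [folklore] -/
theorem cornerEnvelope_ne_top {g : (ι → ℝ) → ℝ≥0∞} {p : ι → ℝ} (h : cornerEssSup g 0 p ≠ ∞) :
    cornerEnvelope g p ≠ ∞ := ne_top_of_le_ne_top h (cornerEnvelope_le_cornerEssSup g 0 p)

/-! ### Monotonicity in the corner -/

/-- **For an a.e.-monotone density the corner essential suprema are monotone in the corner** (at EVERY comparable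
pair; `essSup_lowerCorner_mono`). [this work] -/
theorem cornerEssSup_mono {g : (ι → ℝ) → ℝ≥0∞} (hg : Measurable g)
    (hmono : ∀ᵐ p ∂(volume : Measure (ι → ℝ)).prod volume, p.1 ≤ p.2 → g p.1 ≤ g p.2) (n : ℕ) :
    Monotone (cornerEssSup g n) := fun _ _ hpp' => essSup_lowerCorner_mono hg hmono (cornerRadius_pos n) hpp'

/-- **The envelope of an a.e.-monotone density is monotone at every comparable pair.** [this work] -/
theorem cornerEnvelope_mono {g : (ι → ℝ) → ℝ≥0∞} (hg : Measurable g)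
    (hmono : ∀ᵐ p ∂(volume : Measure (ι → ℝ)).prod volume, p.1 ≤ p.2 → g p.1 ≤ g p.2) :
    Monotone (cornerEnvelope g) := fun _ _ hxy => iInf_mono fun n => cornerEssSup_mono hg hmono n hxy

/-! ### MTP₂ at every pair -/

/-- **The corner essential suprema of an a.e.-MTP₂ density are MTP₂ at EVERY pair** (the superlevel sets in the two
corners have positive measure, so a generic pair of them satisfies the inequality and has its meet and join outside
the null sets above the essential suprema at `p ⊓ q`, `p ⊔ q`; quasi-invariance `volume_prod_inf_mem_null`).
[this work] -/
theorem cornerEssSup_mul_le {g : (ι → ℝ) → ℝ≥0∞} (hg : Measurable g)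
    (hMTP : ∀ᵐ p ∂(volume : Measure (ι → ℝ)).prod volume, g p.1 * g p.2 ≤ g (p.1 ⊓ p.2) * g (p.1 ⊔ p.2))
    (n : ℕ) (p q : ι → ℝ) :
    cornerEssSup g n p * cornerEssSup g n q ≤ cornerEssSup g n (p ⊓ q) * cornerEssSup g n (p ⊔ q) := by
  refine ENNReal.mul_le_of_forall_lt fun a ha b hb => ?_
  set r : ℝ := cornerRadius n with hr
  set A := {x | a < g x} ∩ Set.pi univ fun i => Ioc (p i - r) (p i) with hA
  set B := {y | b < g y} ∩ Set.pi univ fun i => Ioc (q i - r) (q i) with hB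
  have hA0 : volume A ≠ 0 := by
    rw [hA, ← Measure.restrict_apply (measurableSet_lt measurable_const hg)]
    exact measure_ne_zero_of_lt_essSup' ha
  have hB0 : volume B ≠ 0 := by
    rw [hB, ← Measure.restrict_apply (measurableSet_lt measurable_const hg)]
    exact measure_ne_zero_of_lt_essSup' hb
  have hAB : ((volume : Measure (ι → ℝ)).prod volume) (A ×ˢ B) ≠ 0 := by
    rw [Measure.prod_prod]; exact mul_ne_zero hA0 hB0
  set N₃ := {z | cornerEssSup g n (p ⊓ q) < g z} ∩ Set.pi univ fun i => Ioc ((p ⊓ q) i - r) ((p ⊓ q) i) with hN₃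
  set N₄ := {z | cornerEssSup g n (p ⊔ q) < g z} ∩ Set.pi univ fun i => Ioc ((p ⊔ q) i - r) ((p ⊔ q) i) with hN₄
  have hN₃0 : volume N₃ = 0 := measure_inter_eq_zero_of_essSup_restrict_le hg le_rfl
  have hN₄0 : volume N₄ = 0 := measure_inter_eq_zero_of_essSup_restrict_le hg le_rfl
  have good : ∀ᵐ z ∂(volume : Measure (ι → ℝ)).prod volume,
      g z.1 * g z.2 ≤ g (z.1 ⊓ z.2) * g (z.1 ⊔ z.2) ∧ z.1 ⊓ z.2 ∉ N₃ ∧ z.1 ⊔ z.2 ∉ N₄ := by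
    have h3 : ∀ᵐ z ∂(volume : Measure (ι → ℝ)).prod volume, z.1 ⊓ z.2 ∉ N₃ := by
      rw [ae_iff]; simpa only [not_not] using volume_prod_inf_mem_null hN₃0
    have h4 : ∀ᵐ z ∂(volume : Measure (ι → ℝ)).prod volume, z.1 ⊔ z.2 ∉ N₄ := by
      rw [ae_iff]; simpa only [not_not] using volume_prod_sup_mem_null hN₄0
    filter_upwards [hMTP, h3, h4] with z h1 h2 h3 using ⟨h1, h2, h3⟩
  obtain ⟨z, ⟨hzA, hzB⟩, hz1, hz3, hz4⟩ : ∃ z ∈ A ×ˢ B,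
      g z.1 * g z.2 ≤ g (z.1 ⊓ z.2) * g (z.1 ⊔ z.2) ∧ z.1 ⊓ z.2 ∉ N₃ ∧ z.1 ⊔ z.2 ∉ N₄ := by
    by_contra hne
    push Not at hne
    apply hAB
    refine measure_mono_null (fun z hz => ?_) (ae_iff.1 good)
    exact fun h => h.2.2 (hne z hz h.1 h.2.1)
  have hx3 : z.1 ⊓ z.2 ∈ Set.pi univ fun i => Ioc ((p ⊓ q) i - r) ((p ⊓ q) i) := inf_mem_lowerCorner hzA.2 hzB.2
  have hx4 : z.1 ⊔ z.2 ∈ Set.pi univ fun i => Ioc ((p ⊔ q) i - r) ((p ⊔ q) i) := sup_mem_lowerCorner hzA.2 hzB.2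
  have hg3 : g (z.1 ⊓ z.2) ≤ cornerEssSup g n (p ⊓ q) := by
    by_contra hlt
    exact hz3 ⟨not_le.1 hlt, hx3⟩
  have hg4 : g (z.1 ⊔ z.2) ≤ cornerEssSup g n (p ⊔ q) := by
    by_contra hlt
    exact hz4 ⟨not_le.1 hlt, hx4⟩
  calc a * b ≤ g z.1 * g z.2 := mul_le_mul' hzA.1.le hzB.1.le
    _ ≤ g (z.1 ⊓ z.2) * g (z.1 ⊔ z.2) := hz1
    _ ≤ cornerEssSup g n (p ⊓ q) * cornerEssSup g n (p ⊔ q) := mul_le_mul' hg3 hg4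

/-- **The envelope of an a.e.-MTP₂ density is MTP₂ at EVERY pair**, provided the corner essential suprema are
finite (pass to the limit `n → ∞`). [this work] -/
theorem cornerEnvelope_mul_le {g : (ι → ℝ) → ℝ≥0∞} (hg : Measurable g)
    (hMTP : ∀ᵐ p ∂(volume : Measure (ι → ℝ)).prod volume, g p.1 * g p.2 ≤ g (p.1 ⊓ p.2) * g (p.1 ⊔ p.2))
    (hfin : ∀ p, cornerEssSup g 0 p ≠ ∞) (x y : ι → ℝ) :
    cornerEnvelope g x * cornerEnvelope g y ≤ cornerEnvelope g (x ⊓ y) * cornerEnvelope g (x ⊔ y) := by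
  have hFT : ∀ p, cornerEnvelope g p ≠ ∞ := fun p => cornerEnvelope_ne_top (hfin p)
  have hL : Tendsto (fun n => cornerEssSup g n x * cornerEssSup g n y) atTop
      (𝓝 (cornerEnvelope g x * cornerEnvelope g y)) :=
    ENNReal.Tendsto.mul (tendsto_cornerEssSup g x) (Or.inr (hFT y)) (tendsto_cornerEssSup g y) (Or.inr (hFT x))
  have hR : Tendsto (fun n => cornerEssSup g n (x ⊓ y) * cornerEssSup g n (x ⊔ y)) atTop
      (𝓝 (cornerEnvelope g (x ⊓ y) * cornerEnvelope g (x ⊔ y))) :=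
    ENNReal.Tendsto.mul (tendsto_cornerEssSup g _) (Or.inr (hFT _)) (tendsto_cornerEssSup g _) (Or.inr (hFT _))
  exact le_of_tendsto_of_tendsto' hL hR fun n => cornerEssSup_mul_le hg hMTP n x y

/-! ### The envelope is a version -/

/-- **The envelope of an a.e.-monotone density equals the density almost everywhere** (from above: a.e. `p` dominates
almost every point below it; from below: Lebesgue density points of the superlevel sets, a corner box being a
`2^{-|ι|}`-th of the sup-norm ball of the same radius). [this work] -/
theorem cornerEnvelope_ae_eq {g : (ι → ℝ) → ℝ≥0∞} (hg : Measurable g)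
    (hmono : ∀ᵐ p ∂(volume : Measure (ι → ℝ)).prod volume, p.1 ≤ p.2 → g p.1 ≤ g p.2) :
    cornerEnvelope g =ᵐ[volume] g := by
  have hsw : ∀ᵐ z ∂(volume : Measure (ι → ℝ)).prod volume, z.2 ≤ z.1 → g z.2 ≤ g z.1 := by
    have := (Measure.measurePreserving_swap (μ := (volume : Measure (ι → ℝ)))
      (ν := (volume : Measure (ι → ℝ)))).quasiMeasurePreserving.ae hmono
    filter_upwards [this] with z hz using hz
  have hc1 : ∀ᵐ p ∂(volume : Measure (ι → ℝ)), ∀ᵐ x ∂(volume : Measure (ι → ℝ)), x ≤ p → g x ≤ g p :=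
    Measure.ae_ae_of_ae_prod hsw
  have hc2 : ∀ᵐ p ∂(volume : Measure (ι → ℝ)), ∀ t : ℚ, p ∈ {x | ENNReal.ofReal t < g x} →
      Tendsto (fun ρ => volume ({x | ENNReal.ofReal t < g x}ᶜ ∩ closedBall p ρ) / volume (closedBall p ρ))
        (𝓝[>] 0) (𝓝 0) := by
    rw [ae_all_iff]
    intro t
    have mS : MeasurableSet {x : ι → ℝ | ENNReal.ofReal (t : ℝ) < g x} := measurableSet_lt measurable_const hg
    filter_upwards [Besicovitch.ae_tendsto_measure_inter_div_of_measurableSet (volume : Measure (ι → ℝ)) mS.compl]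
      with p hp hpt
    have hn : p ∉ ({x : ι → ℝ | ENNReal.ofReal (t : ℝ) < g x})ᶜ := Set.notMem_compl_iff.2 hpt
    have h0 : ({x : ι → ℝ | ENNReal.ofReal (t : ℝ) < g x}ᶜ).indicator (1 : (ι → ℝ) → ℝ≥0∞) p = 0 :=
      Set.indicator_of_notMem hn _
    rwa [h0] at hp
  filter_upwards [hc1, hc2] with p hp1 hp2
  apply le_antisymm
  · exact cornerEnvelope_le_of_ae_le hp1
  · refine le_iInf fun n => le_of_forall_lt_imp_le_of_dense fun a ha => ?_
    obtain ⟨t, -, hat, htg⟩ := ENNReal.lt_iff_exists_rat_btwn.1 ha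
    change a < ENNReal.ofReal t at hat
    change ENNReal.ofReal t < g p at htg
    refine hat.le.trans ?_
    set S := {x : ι → ℝ | ENNReal.ofReal (t : ℝ) < g x} with hS
    have hd : Tendsto (fun m => volume (Sᶜ ∩ closedBall p (cornerRadius m)) / volume (closedBall p (cornerRadius m)))
        atTop (𝓝 0) := (hp2 t htg).comp tendsto_cornerRadius
    have hsmall : ∀ᶠ m in atTop, volume (Sᶜ ∩ closedBall p (cornerRadius m)) / volume (closedBall p (cornerRadius m)) <
        ((2 : ℝ≥0∞) ^ Fintype.card ι)⁻¹ :=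
      (tendsto_order.1 hd).2 _ (ENNReal.inv_pos.2 (ENNReal.pow_ne_top ENNReal.ofNat_ne_top))
    obtain ⟨m₀, hm₀⟩ := hsmall.exists_forall_of_atTop
    set m := max n m₀ with hm
    refine le_trans ?_ (cornerEssSup_antitone g p (le_max_left n m₀))
    by_contra hlt
    have hz : volume ({x | ENNReal.ofReal (t : ℝ) < g x} ∩
        Set.pi univ fun i => Ioc (p i - cornerRadius m) (p i)) = 0 :=
      measure_inter_eq_zero_of_essSup_restrict_le hg (not_le.1 hlt).le
    have hC : volume (Set.pi univ fun i => Ioc (p i - cornerRadius m) (p i)) =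
        ENNReal.ofReal (cornerRadius m) ^ Fintype.card ι := volume_lowerCorner p (cornerRadius m)
    have hBall : volume (closedBall p (cornerRadius m)) =
        2 ^ Fintype.card ι * ENNReal.ofReal (cornerRadius m) ^ Fintype.card ι :=
      volume_closedBall_eq_pow_mul p (cornerRadius_pos m).le
    have hR0 : ENNReal.ofReal (cornerRadius m) ^ Fintype.card ι ≠ 0 :=
      pow_ne_zero _ (ENNReal.ofReal_pos.2 (cornerRadius_pos m)).ne'
    have hRT : ENNReal.ofReal (cornerRadius m) ^ Fintype.card ι ≠ ∞ := ENNReal.pow_ne_top ENNReal.ofReal_ne_top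
    have h2T : (2 : ℝ≥0∞) ^ Fintype.card ι ≠ ∞ := ENNReal.pow_ne_top ENNReal.ofNat_ne_top
    have h20 : (2 : ℝ≥0∞) ^ Fintype.card ι ≠ 0 := pow_ne_zero _ two_ne_zero
    have hB0 : volume (closedBall p (cornerRadius m)) ≠ 0 := by rw [hBall]; exact mul_ne_zero h20 hR0
    have hBT : volume (closedBall p (cornerRadius m)) ≠ ∞ := by rw [hBall]; exact ENNReal.mul_ne_top h2T hRT
    have hlt' : volume (Sᶜ ∩ closedBall p (cornerRadius m)) <
        volume (Set.pi univ fun i => Ioc (p i - cornerRadius m) (p i)) := by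
      have h1 := (ENNReal.div_lt_iff (Or.inl hB0) (Or.inl hBT)).1 (hm₀ m (le_max_right n m₀))
      rw [hBall, ← mul_assoc, ENNReal.inv_mul_cancel h20 h2T, one_mul, ← hC] at h1
      exact h1
    have hsub : (Set.pi univ fun i => Ioc (p i - cornerRadius m) (p i)) ⊆
        ({x | ENNReal.ofReal (t : ℝ) < g x} ∩ Set.pi univ fun i => Ioc (p i - cornerRadius m) (p i)) ∪
          (Sᶜ ∩ closedBall p (cornerRadius m)) := by
      intro x hx
      by_cases hxS : x ∈ S
      · exact Or.inl ⟨hxS, hx⟩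
      · exact Or.inr ⟨hxS, lowerCorner_subset_closedBall p (cornerRadius_pos m).le hx⟩
    have hle : volume (Set.pi univ fun i => Ioc (p i - cornerRadius m) (p i)) ≤
        volume ({x | ENNReal.ofReal (t : ℝ) < g x} ∩ Set.pi univ fun i => Ioc (p i - cornerRadius m) (p i)) +
          volume (Sᶜ ∩ closedBall p (cornerRadius m)) :=
      (measure_mono hsub).trans (measure_union_le _ _)
    rw [hz, zero_add] at hle
    exact (lt_irrefl _) (hlt'.trans_le hle)

/-! ### Summary: the explicit form of the local envelope theorem -/

/-- **The explicit local envelope theorem.**  For `g : ℝ^ι → [0, ∞]` measurable, MTP₂ on Lebesgue-almost every pair,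
non-decreasing on almost every comparable pair and locally bounded below every point (`g ≤ M_q < ∞` a.e. on
`{z ≤ q}`), the NAMED envelope `cornerEnvelope g` is Borel, finite, `= g` almost everywhere, MTP₂ at every pair and
monotone at every comparable pair (the function produced by `exists_measurable_monotone_mtp2_version_of_ae_local`).
[this work] -/
theorem cornerEnvelope_spec_local {g : (ι → ℝ) → ℝ≥0∞} (hg : Measurable g)
    (hloc : ∀ q : ι → ℝ, ∃ M : ℝ≥0∞, M ≠ ∞ ∧ ∀ᵐ z ∂(volume : Measure (ι → ℝ)), z ≤ q → g z ≤ M)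
    (hMTP : ∀ᵐ p ∂(volume : Measure (ι → ℝ)).prod volume, g p.1 * g p.2 ≤ g (p.1 ⊓ p.2) * g (p.1 ⊔ p.2))
    (hmono : ∀ᵐ p ∂(volume : Measure (ι → ℝ)).prod volume, p.1 ≤ p.2 → g p.1 ≤ g p.2) :
    Measurable (cornerEnvelope g) ∧ (∀ x, cornerEnvelope g x ≠ ∞) ∧ cornerEnvelope g =ᵐ[volume] g ∧
      (∀ x y, cornerEnvelope g x * cornerEnvelope g y ≤ cornerEnvelope g (x ⊓ y) * cornerEnvelope g (x ⊔ y)) ∧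
      Monotone (cornerEnvelope g) :=
  ⟨measurable_cornerEnvelope hg, fun x => cornerEnvelope_ne_top (cornerEssSup_ne_top_of_local hloc 0 x),
    cornerEnvelope_ae_eq hg hmono,
    fun x y => cornerEnvelope_mul_le hg hMTP (fun p => cornerEssSup_ne_top_of_local hloc 0 p) x y,
    cornerEnvelope_mono hg hmono⟩

end Summit.CriticalPhenomena.PercolationContinuityZ3.Theorems.SahiAEFourFunctions
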